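import Summits.CriticalPhenomena.SAWScalingLimit.Theses.SAWQuarterTwist
import Summits.CriticalPhenomena.SAWScalingLimit.Theorems.SAWDefectDecoherenceObservableToSLERResidueAssembly3

/-! Part 1 (children + modus-ponens glue; elaborates with the route imports alone: see SplitSketch_s5a.lean rc 0) -/

namespace Summit.CriticalPhenomena.SAWScalingLimit.Theses.SAWQuarterTwist

/-- child 1 = item stmt-CriticalPhenomena-17955 verbatim (MACROSCOPIC SOURCE LOCALITY, the weakened anchor). -/
def MacroSourceLocality : Prop :=
  ∀ (E : Literature.Probability.RandomPlanarGeometry.DobrushinDomain) (ρ : ℝ) (Λ : ℝ → Finset Literature.Probability.LatticeModels.HexVertex) (m₀ : ℝ → ℤ) (a : ℝ → Sym2 Literature.Probability.LatticeModels.HexVertex), 0 < ρ → E.carrier ∩ Metric.ball (E.pt 0) ρ = {z : ℂ | (E.pt 0).im < z.im} ∩ Metric.ball (E.pt 0) ρ → (∀ᶠ δ : ℝ in nhdsWithin 0 (Set.Ioi 0), Literature.Probability.RandomPlanarGeometry.SAW.hexDomainSimplyConnected (Λ δ) ∧ (Literature.Probability.LatticeModels.hexGraph.induce ((Λ δ :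 Finset Literature.Probability.LatticeModels.HexVertex) : Set Literature.Probability.LatticeModels.HexVertex)).Preconnected ∧ a δ ∈ Literature.Probability.RandomPlanarGeometry.SAW.hexDomainBoundary (Λ δ) ∧ (∀ v ∈ Λ δ, (δ : ℂ) * Literature.Probability.LatticeModels.hexCenter v ∈ E.carrier) ∧ (∀ v : Literature.Probability.LatticeModels.HexVertex, (δ : ℂ) * Literature.Probability.LatticeModels.hexCenter v ∈ Metric.ball (E.pt 0) ρ → (v ∈ Λ δ ↔ m₀ δ ≤ v.1 1))) → (∀ K : Set ℂ, IsCompact K → K ⊆ E.carrier → ∀ᶠ δ : ℝ in nhdsWithin 0 (Set.Ioi 0), ∀ v : Literature.Probability.LatticeModels.HexVertex, (δ : ℂ) * Literature.Probability.LatticeModels.hexCenter v ∈ K → v ∈ Λ δ) → Filter.Tendsto (fun δ : ℝ => (δ : ℂ) * Literature.Probability.RandomPlanarGeometry.SAW.hexMidpoint (a δ)) (nhdsWithin 0 (Set.Ioi 0)) (nhds (E.pt 0)) → ∀ ε : ℝ, 0 < ε → ∀ r : ℝ, 0 < r → ∃ t₀ : ℝ, 0 < t₀ ∧ ∀ (s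 : ℝ → Sym2 Literature.Probability.LatticeModels.HexVertex) (t : ℝ), t ≠ 0 → |t| < t₀ → (∀ᶠ δ : ℝ in nhdsWithin 0 (Set.Ioi 0), s δ ∈ Literature.Probability.RandomPlanarGeometry.SAW.hexDomainBoundary (Λ δ) ∧ (Literature.Probability.RandomPlanarGeometry.SAW.hexMidpoint (s δ)).im = (Literature.Probability.RandomPlanarGeometry.SAW.hexMidpoint (a δ)).im) → Filter.Tendsto (fun δ : ℝ => (δ : ℂ) * Literature.Probability.RandomPlanarGeometry.SAW.hexMidpoint (s δ)) (nhdsWithin 0 (Set.Ioi 0)) (nhds (E.pt 0 + t)) → ∀ᶠ δ : ℝ in nhdsWithin 0 (Set.Ioi 0), (∑ γ : Literature.Probability.RandomPlanarGeometry.SAW.HexMidEdgeSAW (Λ δ) (a δ) (s δ), if ∃ v ∈ γ.verts, r ≤ dist ((δ : ℂ) * Literature.Probability.LatticeModels.hexCenter v) ((δ : ℂ) * Literature.Probability.RandomPlanarGeometry.SAW.hexMidpoint (a δ)) then Literature.Probability.RandomPlanarGeometry.SAW.hexCriticalFugacity ^ γ.length else 0) ≤ ε * ∑ γ : Literature.Probability.RandomPlanarGeometry.SAW.HexMidEdgeSAW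 (Λ δ) (a δ) (s δ), Literature.Probability.RandomPlanarGeometry.SAW.hexCriticalFugacity ^ γ.length

/-- child 2 = item stmt-CriticalPhenomena-7148 verbatim (SIMPLICITY of subsequential limits). -/
def HexSimpleSubseqLimits : Prop :=
  ∀ (D : Literature.Probability.RandomPlanarGeometry.DobrushinDomain) (a b : ℝ → Literature.Probability.LatticeModels.HexVertex), Literature.Probability.RandomPlanarGeometry.SAW.IsEmbEndpointApprox Literature.Probability.LatticeModels.hexGraph Literature.Probability.LatticeModels.hexCenter D a b → ∀ (s : ℕ → ℝ) (ν : MeasureTheory.Measure (Literature.Probability.RandomPlanarGeometry.CurveClass ℂ)), Filter.Tendsto s Filter.atTop (nhdsWithin 0 (Set.Ioi 0)) → MeasureTheory.IsProbabilityMeasure ν → (∀ f : BoundedContinuousFunction (Literature.Probability.RandomPlanarGeometry.CurveClass ℂ) ℝ, Filter.Tendsto (fun n => ∫ γ, f γ.curve ∂(Literature.Probability.RandomPlanarGeometry.SAW.hexSAWLaw D.carrier (s n) (a (s n)) (b (s n)))) Filter.atTop (nhds (∫ x, f x ∂ν))) → ∀ᵐ γ ∂ν, γ ∈ Literature.Probability.RandomPlanarGeometry.CurveClass.simple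 ∧ γ.source = D.pt 0 ∧ γ.target = D.pt 1 ∧ γ.range ⊆ closure D.carrier ∧ γ.range ∩ frontier D.carrier ⊆ {D.pt 0, D.pt 1}

/-- child 3 (NEW): the ABUNDANCE HALF — given the weakened anchor and simplicity, the crux. -/
def AnchoredObservableToSLER : Prop :=
  MacroSourceLocality → HexSimpleSubseqLimits → HexObservableLimitR → HexTight → ∀ (D : Literature.Probability.RandomPlanarGeometry.DobrushinDomain) (a b : ℝ → Literature.Probability.LatticeModels.HexVertex), Literature.Probability.RandomPlanarGeometry.SAW.IsEmbEndpointApprox Literature.Probability.LatticeModels.hexGraph Literature.Probability.LatticeModels.hexCenter D a b → Literature.Probability.RandomPlanarGeometry.ConvergesInLawToSLE ((8 : NNReal) / 3) D (fun δ (γ : Literature.Probability.RandomPlanarGeometry.SAW.HexDomainSAW D.carrier δ (a δ) (b δ)) => γ.curve) (fun δ => Literature.Probability.RandomPlanarGeometry.SAW.hexSAWLaw D.carrier δ (a δ) (b δ))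

/-- The split glue: modus ponens. -/
theorem ObservableToSLER_of_subs :
    MacroSourceLocality → HexSimpleSubseqLimits → AnchoredObservableToSLER → ObservableToSLER :=
  fun hM hS hA => hA hM hS

/-- child 3 is literally `MacroSourceLocality → HexSimpleSubseqLimits → ObservableToSLER`. -/
theorem anchored_iff : AnchoredObservableToSLER ↔ (MacroSourceLocality → HexSimpleSubseqLimits → ObservableToSLER) :=
  Iff.rfl

end Summit.CriticalPhenomena.SAWScalingLimit.Theses.SAWQuarterTwist

/-!
# Strategist s5 — split certificate, part 2: what child 3 (`AnchoredObservableToSLER`) still owes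

Kernel fact: given ABUNDANCE (item stmt-CriticalPhenomena-17698 = registered stub `stub_nestedRenewalFatCoSolidR`,
hypothesis `h2` below VERBATIM from the landed glue) and the SOLID MOVING-CARVING SQUEEZE (`hSq`, verbatim the fourth
hypothesis of `Residue.observableToSLER_of_residueMacro`, p148257; provable — its pieces are landed on the twin crux
stmt-10472, r13 "provable half closed"), child 3 of the SAWQuarterTwist split holds.  The landed glue concludes the
SAWDefectDecoherence copy of the crux; the SAWQuarterTwist copy is the same term (the five route copies are `Iff.rfl`,
Disproof §1), so the transport is definitional.
-/

noncomputable section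

open scoped BigOperators Topology NNReal ENNReal Classical BoundedContinuousFunction
open Filter Set MeasureTheory Metric
open Literature.Probability.LatticeModels (HexVertex hexGraph hexCenter triZeta Site polyline)
open Literature.Probability.RandomPlanarGeometry
open Literature.Probability.RandomPlanarGeometry.SAW
open UpperHalfPlane (upperHalfPlaneSet)
open Summit.CriticalPhenomena.SAWScalingLimit.Theorems.ObservableToSLER.BridgeGate
open Summit.CriticalPhenomena.SAWScalingLimit.Theorems.ObservableToSLER.NestedGate

namespace Summit.CriticalPhenomena.SAWScalingLimit.Cruxes.ObservableToSLER.StrategistS5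

/-- The five route copies of the crux are one term. -/
theorem crux_copies_rfl :
    Summit.CriticalPhenomena.SAWScalingLimit.Theses.SAWDefectDecoherence.ObservableToSLER ↔
      Summit.CriticalPhenomena.SAWScalingLimit.Theses.SAWQuarterTwist.ObservableToSLER :=
  Iff.rfl

/-- Child 1 of the split is, as a term, the anchor hypothesis `h5a1` of the landed glue. -/
theorem child1_rfl :
    Summit.CriticalPhenomena.SAWScalingLimit.Theses.SAWQuarterTwist.MacroSourceLocality ↔
      (∀ (E : DobrushinDomain) (ρ : ℝ) (Λ : ℝ → Finset HexVertex) (m₀ : ℝ → ℤ)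
        (a : ℝ → Sym2 HexVertex),
        0 < ρ → E.carrier ∩ ball (E.pt 0) ρ = {z : ℂ | (E.pt 0).im < z.im} ∩ ball (E.pt 0) ρ →
        (∀ᶠ δ : ℝ in 𝓝[>] 0, hexDomainSimplyConnected (Λ δ) ∧
          (hexGraph.induce (↑(Λ δ) : Set HexVertex)).Preconnected ∧ a δ ∈ hexDomainBoundary (Λ δ) ∧
          (∀ v ∈ Λ δ, (δ : ℂ) * hexCenter v ∈ E.carrier) ∧
          (∀ v : HexVertex, (δ : ℂ) * hexCenter v ∈ ball (E.pt 0) ρ → (v ∈ Λ δ ↔ m₀ δ ≤ v.1 1))) →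
        (∀ K : Set ℂ, IsCompact K → K ⊆ E.carrier →
          ∀ᶠ δ : ℝ in 𝓝[>] 0, ∀ v : HexVertex, (δ : ℂ) * hexCenter v ∈ K → v ∈ Λ δ) →
        Tendsto (fun δ : ℝ => (δ : ℂ) * hexMidpoint (a δ)) (𝓝[>] 0) (𝓝 (E.pt 0)) →
        ∀ ε : ℝ, 0 < ε → ∀ r : ℝ, 0 < r → ∃ t₀ : ℝ, 0 < t₀ ∧
          ∀ (s : ℝ → Sym2 HexVertex) (t : ℝ), t ≠ 0 → |t| < t₀ →
            (∀ᶠ δ : ℝ in 𝓝[>] 0, s δ ∈ hexDomainBoundary (Λ δ) ∧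
              (hexMidpoint (s δ)).im = (hexMidpoint (a δ)).im) →
            Tendsto (fun δ : ℝ => (δ : ℂ) * hexMidpoint (s δ)) (𝓝[>] 0) (𝓝 (E.pt 0 + t)) →
            ∀ᶠ δ : ℝ in 𝓝[>] 0,
              (∑ γ : HexMidEdgeSAW (Λ δ) (a δ) (s δ),
                  if ∃ v ∈ γ.verts, r ≤ dist ((δ : ℂ) * hexCenter v) ((δ : ℂ) * hexMidpoint (a δ))
                  then hexCriticalFugacity ^ γ.length else 0) ≤
                ε * ∑ γ : HexMidEdgeSAW (Λ δ) (a δ) (s δ), hexCriticalFugacity ^ γ.length) :=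
  Iff.rfl

/-- **Child 3 ⇐ abundance + squeeze** (the squeeze provable): kernel-checked against the landed residue glue. -/
theorem anchored_of_abundance_of_squeeze
    (h2 : ∀ (D : DobrushinDomain) (a b : ℝ → HexVertex), IsEmbEndpointApprox hexGraph hexCenter D a b →
        ∀ ε > (0 : ℝ), ∃ R₂ > (0 : ℝ), ∀ R ∈ Set.Ioc (0 : ℝ) R₂, ∃ ρ > (0 : ℝ), ∃ N : ℕ, ∀ᶠ δ : ℝ in 𝓝[>] 0,
          ∃ S T : ℕ → Set HexVertex,
            TameNestedFamily δ R N (a δ) S ∧ TameNestedFamily δ R N (b δ) T ∧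
            ((∀ n, ExteriorAnchored D.carrier δ (S n) (a δ)) ∧
              (∀ n, ExteriorAnchored D.carrier δ (T n) (b δ)) ∧
              ∃ j : Fin 6,
                ((∀ (n : ℕ) (p q : HexVertex), HasCleanWindow D.carrier δ ρ (S n) p q →
                    rowOf j q = rowOf j p + 1 ∧
                      ∀ x : HexVertex, (δ : ℂ) * hexCenter x ∈ ball ((δ : ℂ) * hexCenter q) ρ →
                        (x ∈ S n ↔ rowOf j x ≤ rowOf j p)) ∧
                  (∀ (n : ℕ) (p q : HexVertex), HasCleanWindow D.carrier δ ρ (T n) p q →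
                    rowOf j q = rowOf j p + 1 ∧
                      ∀ x : HexVertex, (δ : ℂ) * hexCenter x ∈ ball ((δ : ℂ) * hexCenter q) ρ →
                        (x ∈ T n ↔ rowOf j x ≤ rowOf j p))) ∧
                (∀ (n : ℕ) (p q : HexVertex), HasCleanWindow D.carrier δ ρ (S n) p q →
                  ∃ K : Set ℂ, IsCompact K ∧ IsConnected K ∧
                    (δ : ℂ) * hexCenter q - ((ρ / 2 : ℝ) : ℂ) * Complex.I * triZeta ^ (j : ℕ) ∈ K ∧
                    (δ : ℂ) * hexCenter (a δ) ∈ K ∧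
                    ∀ v : HexVertex, Metric.infDist ((δ : ℂ) * hexCenter v) K ≤ ρ / 4 → v ∈ S n) ∧
                (∀ (n : ℕ) (p q : HexVertex), HasCleanWindow D.carrier δ ρ (T n) p q →
                  ∃ K : Set ℂ, IsCompact K ∧ IsConnected K ∧
                    (δ : ℂ) * hexCenter q - ((ρ / 2 : ℝ) : ℂ) * Complex.I * triZeta ^ (j : ℕ) ∈ K ∧
                    (δ : ℂ) * hexCenter (b δ) ∈ K ∧
                    ∀ v : HexVertex, Metric.infDist ((δ : ℂ) * hexCenter v) K ≤ ρ / 4 → v ∈ T n) ∧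
                (∀ n : ℕ, ∃ K : Set ℂ, IsCompact K ∧ IsConnected K ∧ (δ : ℂ) * hexCenter (a δ) ∈ K ∧
                  (∀ v : HexVertex, Metric.infDist ((δ : ℂ) * hexCenter v) K ≤ ρ / 8 → v ∈ S n) ∧
                  (∀ v ∈ S n, ∃ (t w : HexVertex) (r : ℕ), v ∈ hexBall t r ∧ w ∈ hexBall t r ∧
                    hexBall t r ⊆ S n ∧ Metric.infDist ((δ : ℂ) * hexCenter w) K ≤ ρ / 16)) ∧
                (∀ n : ℕ, ∃ K : Set ℂ, IsCompact K ∧ IsConnected K ∧ (δ : ℂ) * hexCenter (b δ) ∈ K ∧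
                  (∀ v : HexVertex, Metric.infDist ((δ : ℂ) * hexCenter v) K ≤ ρ / 8 → v ∈ T n) ∧
                  (∀ v ∈ T n, ∃ (t w : HexVertex) (r : ℕ), v ∈ hexBall t r ∧ w ∈ hexBall t r ∧
                    hexBall t r ⊆ T n ∧ Metric.infDist ((δ : ℂ) * hexCenter w) K ≤ ρ / 16))) ∧
            hexSAWLaw D.carrier δ (a δ) (b δ)
                {γ | ¬ ∃ (n m : ℕ) (p q : HexVertex) (n' m' : ℕ) (p' q' : HexVertex),
                    IsFirstGoodGateN D.carrier δ ρ R S (a δ) γ.walk.support n m p q ∧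
                    IsFirstGoodGateN D.carrier δ ρ R T (b δ) γ.walk.support.reverse n' m' p' q' ∧
                    WideLink D.carrier δ ρ (S n ∪ T n') q q'} ≤
              ENNReal.ofReal ε)
    (hSq : (∀ (D D' : DobrushinDomain) (ρ : ℝ) (φ : ConformalEquiv upperHalfPlaneSet D.carrier)
        (Φ : ConformalEquiv (upperHalfPlaneSet \ φ.pullbackHull D') upperHalfPlaneSet) (d : ℝ)
        (Λ Λ' : ℝ → Finset HexVertex) (m₀ m₁ m₁' : ℝ → ℤ) (a b : ℝ → Sym2 HexVertex),
        (0 < ρ ∧ ∀ i : Fin 2, D.carrier ∩ ball (D.pt i) ρ = {z : ℂ | (D.pt i).im < z.im} ∩ ball (D.pt i) ρ) →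
        D.IsHullSubdomain D' → D.IsChordalUniformizing φ →
        IsRestrictionMap (φ.pullbackHull D') Φ → HasRestrictionDeriv (φ.pullbackHull D') Φ d →
        (∀ᶠ δ : ℝ in 𝓝[>] 0,
          Λ' δ ⊆ Λ δ ∧ hexDomainSimplyConnected (Λ δ) ∧ hexDomainSimplyConnected (Λ' δ) ∧
          (hexGraph.induce (↑(Λ δ) : Set HexVertex)).Preconnected ∧
          (hexGraph.induce (↑(Λ' δ) : Set HexVertex)).Preconnected ∧
          a δ ∈ hexDomainBoundary (Λ δ) ∧ b δ ∈ hexDomainBoundary (Λ δ) ∧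
          a δ ∈ hexDomainBoundary (Λ' δ) ∧ b δ ∈ hexDomainBoundary (Λ' δ) ∧
          Nonempty (HexMidEdgeSAW (Λ' δ) (a δ) (b δ)) ∧
          (∀ v ∈ Λ δ, (δ : ℂ) * hexCenter v ∈ D.carrier) ∧
          (∀ v ∈ Λ' δ, (δ : ℂ) * hexCenter v ∈ D'.carrier) ∧
          (∀ v : HexVertex, (δ : ℂ) * hexCenter v ∈ ball (D.pt 0) ρ →
            ((v ∈ Λ δ ↔ m₀ δ ≤ v.1 1) ∧ (v ∈ Λ' δ ↔ m₀ δ ≤ v.1 1))) ∧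
          (∀ v : HexVertex, (δ : ℂ) * hexCenter v ∈ ball (D.pt 1) ρ →
            ((v ∈ Λ δ ↔ m₁ δ ≤ v.1 1) ∧ (v ∈ Λ' δ ↔ m₁' δ ≤ v.1 1)))) →
        (∀ K : Set ℂ, IsCompact K → K ⊆ D.carrier →
          ∀ᶠ δ : ℝ in 𝓝[>] 0, ∀ v : HexVertex, (δ : ℂ) * hexCenter v ∈ K → v ∈ Λ δ) →
        (∀ K : Set ℂ, IsCompact K → K ⊆ D'.carrier →
          ∀ᶠ δ : ℝ in 𝓝[>] 0, ∀ v : HexVertex, (δ : ℂ) * hexCenter v ∈ K → v ∈ Λ' δ) →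
        Tendsto (fun δ : ℝ => (δ : ℂ) * hexMidpoint (a δ)) (𝓝[>] 0) (𝓝 (D.pt 0)) →
        Tendsto (fun δ : ℝ => (δ : ℂ) * hexMidpoint (b δ)) (𝓝[>] 0) (𝓝 (D.pt 1)) →
        Tendsto (fun δ : ℝ =>
            (∑ γ : HexMidEdgeSAW (Λ' δ) (a δ) (b δ), hexCriticalFugacity ^ γ.length) /
              (∑ γ : HexMidEdgeSAW (Λ δ) (a δ) (b δ), hexCriticalFugacity ^ γ.length)) (𝓝[>] 0)
          (𝓝 (d ^ ((5 : ℝ) / 8)))) →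
      (∀ (D : DobrushinDomain) (a b : ℝ → HexVertex), IsEmbEndpointApprox hexGraph hexCenter D a b →
        ∀ η > (0 : ℝ), ∃ R₀ > (0 : ℝ), ∀ R ∈ Set.Ioc (0 : ℝ) R₀, ∀ ρ > (0 : ℝ), ∀ N : ℕ,
            ∀ (δ : ℕ → ℝ) (S T : ℕ → ℕ → Set HexVertex) (n n' : ℕ → ℕ) (q q' : ℕ → HexVertex),
              Tendsto δ atTop (𝓝[>] 0) →
              (∀ k, TameNestedFamily (δ k) R N (a (δ k)) (S k) ∧
                TameNestedFamily (δ k) R N (b (δ k)) (T k) ∧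
                (((∀ i, ExteriorAnchored D.carrier (δ k) (S k i) (a (δ k))) ∧
            (∀ i, ExteriorAnchored D.carrier (δ k) (T k i) (b (δ k))) ∧
            (∀ (i : ℕ) (p q : HexVertex), HasCleanWindow D.carrier (δ k) ρ (S k i) p q →
              rowOf 0 q = rowOf 0 p + 1 ∧
                ∀ x : HexVertex, ((δ k : ℝ) : ℂ) * hexCenter x ∈ ball (((δ k : ℝ) : ℂ) * hexCenter q) ρ →
                  (x ∈ S k i ↔ rowOf 0 x ≤ rowOf 0 p)) ∧
            (∀ (i : ℕ) (p q : HexVertex), HasCleanWindow D.carrier (δ k) ρ (T k i) p q →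
              rowOf 0 q = rowOf 0 p + 1 ∧
                ∀ x : HexVertex, ((δ k : ℝ) : ℂ) * hexCenter x ∈ ball (((δ k : ℝ) : ℂ) * hexCenter q) ρ →
                  (x ∈ T k i ↔ rowOf 0 x ≤ rowOf 0 p))) ∧
            (∀ (i : ℕ) (p q : HexVertex), HasCleanWindow D.carrier (δ k) ρ (S k i) p q →
              ∃ K : Set ℂ, IsCompact K ∧ IsConnected K ∧
                ((δ k : ℝ) : ℂ) * hexCenter q - ((ρ / 2 : ℝ) : ℂ) * Complex.I ∈ K ∧ ((δ k : ℝ) : ℂ) * hexCenter (a (δ k)) ∈ K ∧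
                ∀ v : HexVertex, Metric.infDist (((δ k : ℝ) : ℂ) * hexCenter v) K ≤ ρ / 4 → v ∈ S k i) ∧
            (∀ (i : ℕ) (p q : HexVertex), HasCleanWindow D.carrier (δ k) ρ (T k i) p q →
              ∃ K : Set ℂ, IsCompact K ∧ IsConnected K ∧
                ((δ k : ℝ) : ℂ) * hexCenter q - ((ρ / 2 : ℝ) : ℂ) * Complex.I ∈ K ∧ ((δ k : ℝ) : ℂ) * hexCenter (b (δ k)) ∈ K ∧
                ∀ v : HexVertex, Metric.infDist (((δ k : ℝ) : ℂ) * hexCenter v) K ≤ ρ / 4 → v ∈ T k i) ∧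
            (∀ i : ℕ, ∃ K : Set ℂ, IsCompact K ∧ IsConnected K ∧ ((δ k : ℝ) : ℂ) * hexCenter (a (δ k)) ∈ K ∧
              (∀ v : HexVertex, Metric.infDist (((δ k : ℝ) : ℂ) * hexCenter v) K ≤ ρ / 8 → v ∈ S k i) ∧
              (∀ v ∈ S k i, ∃ (t w : HexVertex) (r : ℕ), v ∈ hexBall t r ∧ w ∈ hexBall t r ∧
                hexBall t r ⊆ S k i ∧ Metric.infDist (((δ k : ℝ) : ℂ) * hexCenter w) K ≤ ρ / 16)) ∧
            (∀ i : ℕ, ∃ K : Set ℂ, IsCompact K ∧ IsConnected K ∧ ((δ k : ℝ) : ℂ) * hexCenter (b (δ k)) ∈ K ∧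
              (∀ v : HexVertex, Metric.infDist (((δ k : ℝ) : ℂ) * hexCenter v) K ≤ ρ / 8 → v ∈ T k i) ∧
              (∀ v ∈ T k i, ∃ (t w : HexVertex) (r : ℕ), v ∈ hexBall t r ∧ w ∈ hexBall t r ∧
                hexBall t r ⊆ T k i ∧ Metric.infDist (((δ k : ℝ) : ℂ) * hexCenter w) K ≤ ρ / 16)))) →
              (∀ k, ∃ (γ : HexDomainSAW D.carrier (δ k) (a (δ k)) (b (δ k))) (m : ℕ) (p : HexVertex)
                  (m' : ℕ) (p' : HexVertex),
                IsFirstGoodGateN D.carrier (δ k) ρ R (S k) (a (δ k)) γ.walk.support (n k) m p (q k) ∧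
                IsFirstGoodGateN D.carrier (δ k) ρ R (T k) (b (δ k)) γ.walk.support.reverse
                  (n' k) m' p' (q' k) ∧
                WideLink D.carrier (δ k) ρ (S k (n k) ∪ T k (n' k)) (q k) (q' k)) →
              ∀ ε' > (0 : ℝ), ∀ φ : ℕ → ℕ, StrictMono φ →
                ∃ (ψ : ℕ → ℕ) (M : DobrushinDomain) (τ : ℂ) (ρ' : ℝ) (Λ' : ℝ → Finset HexVertex)
                  (m : Fin 2 → ℝ → ℤ) (a' b' : ℝ → Sym2 HexVertex) (x : ℕ → Site 2)
                  (Λ'' : ℕ → Finset HexVertex) (pu pv : ℕ → HexVertex),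
                  StrictMono ψ ∧
                  (∀ t : ℝ, dist (M.boundary t + τ) (D.boundary t) ≤ η) ∧
                  dist (M.pt 0 + τ) (D.pt 0) ≤ η ∧ dist (M.pt 1 + τ) (D.pt 1) ≤ η ∧
                  (0 < ρ' ∧ ∀ i : Fin 2,
                    M.carrier ∩ ball (M.pt i) ρ' = {z : ℂ | (M.pt i).im < z.im} ∩ ball (M.pt i) ρ') ∧
                  (∀ᶠ δ' : ℝ in 𝓝[>] 0, hexDomainSimplyConnected (Λ' δ') ∧
                    a' δ' ∈ hexDomainBoundary (Λ' δ') ∧ b' δ' ∈ hexDomainBoundary (Λ' δ') ∧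
                    Nonempty (HexMidEdgeSAW (Λ' δ') (a' δ') (b' δ')) ∧
                    (hexGraph.induce (↑(Λ' δ') : Set HexVertex)).Preconnected ∧
                    (∀ v ∈ Λ' δ', (δ' : ℂ) * hexCenter v ∈ M.carrier) ∧
                    (∀ i : Fin 2, ∀ v : HexVertex, (δ' : ℂ) * hexCenter v ∈ ball (M.pt i) ρ' →
                      (v ∈ Λ' δ' ↔ m i δ' ≤ v.1 1))) ∧
                  (∀ K : Set ℂ, IsCompact K → K ⊆ M.carrier →
                    ∀ᶠ δ' : ℝ in 𝓝[>] 0, ∀ v : HexVertex, (δ' : ℂ) * hexCenter v ∈ K → v ∈ Λ' δ') ∧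
                  Tendsto (fun δ' : ℝ => (δ' : ℂ) * hexMidpoint (a' δ')) (𝓝[>] 0) (𝓝 (M.pt 0)) ∧
                  Tendsto (fun δ' : ℝ => (δ' : ℂ) * hexMidpoint (b' δ')) (𝓝[>] 0) (𝓝 (M.pt 1)) ∧
                  Tendsto (fun j : ℕ => ((δ (φ (ψ j)) : ℝ) : ℂ) *
                    Literature.Probability.LatticeModels.triEmbed (x j)) atTop (𝓝 τ) ∧
                  (∀ j : ℕ,
                    (∀ w : HexVertex, w ∈ Λ'' j ↔ ((-(x j) + w.1, w.2) : HexVertex) ∈ Λ' (δ (φ (ψ j)))) ∧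
                    (∀ w ∈ Λ'' j, w ∉ S (φ (ψ j)) (n (φ (ψ j))) ∪ T (φ (ψ j)) (n' (φ (ψ j)))) ∧
                    (∀ w ∈ Λ'' j, ∀ y ∈ Λ'' j, hexGraph.Adj w y →
                      (hexDomainGraph D.carrier (δ (φ (ψ j)))).Adj w y) ∧
                    q (φ (ψ j)) ∈ Λ'' j ∧
                    pu j ∈ S (φ (ψ j)) (n (φ (ψ j))) ∪ T (φ (ψ j)) (n' (φ (ψ j))) ∧
                    pv j ∈ S (φ (ψ j)) (n (φ (ψ j))) ∪ T (φ (ψ j)) (n' (φ (ψ j))) ∧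
                    hexGraph.Adj (q (φ (ψ j))) (pu j) ∧
                    s(q (φ (ψ j)), pu j) ≠ s(q' (φ (ψ j)), pv j) ∧
                    (a' (δ (φ (ψ j)))).map (fun w : HexVertex => ((x j + w.1, w.2) : HexVertex)) =
                      s(q (φ (ψ j)), pu j) ∧
                    (b' (δ (φ (ψ j)))).map (fun w : HexVertex => ((x j + w.1, w.2) : HexVertex)) =
                      s(q' (φ (ψ j)), pv j)) ∧
                  (∀ᶠ j : ℕ in atTop, 1 - ε' ≤
                    (carvedLaw D.carrier (δ (φ (ψ j))) (S (φ (ψ j)) (n (φ (ψ j))) ∪ T (φ (ψ j)) (n' (φ (ψ j))))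
                      (q (φ (ψ j))) (q' (φ (ψ j))) {ξ | ∀ w ∈ ξ.walk.support, w ∈ Λ'' j}).toReal))) :
    Summit.CriticalPhenomena.SAWScalingLimit.Theses.SAWQuarterTwist.AnchoredObservableToSLER :=
  fun hM hS =>
    Summit.CriticalPhenomena.SAWScalingLimit.Theorems.ObservableToSLER.Residue.observableToSLER_of_residueMacro
      h2 hM hS hSq

/-- **Child 3 ⇐ abundance ALONE** (r2, after the squeeze landed as `Squeeze.carvedReduction_squeezeSolid` p163920 and the three-item glue
`Residue.observableToSLER_of_residue3` p165010): child 3's open content is EXACTLY item stmt-CriticalPhenomena-17698. -/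
theorem anchored_of_abundance
    (h2 :       ∀ (D : DobrushinDomain) (a b : ℝ → HexVertex), IsEmbEndpointApprox hexGraph hexCenter D a b →
        ∀ ε > (0 : ℝ), ∃ R₂ > (0 : ℝ), ∀ R ∈ Set.Ioc (0 : ℝ) R₂, ∃ ρ > (0 : ℝ), ∃ N : ℕ, ∀ᶠ δ : ℝ in 𝓝[>] 0,
          ∃ S T : ℕ → Set HexVertex,
            TameNestedFamily δ R N (a δ) S ∧ TameNestedFamily δ R N (b δ) T ∧
            ((∀ n, ExteriorAnchored D.carrier δ (S n) (a δ)) ∧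
              (∀ n, ExteriorAnchored D.carrier δ (T n) (b δ)) ∧
              ∃ j : Fin 6,
                ((∀ (n : ℕ) (p q : HexVertex), HasCleanWindow D.carrier δ ρ (S n) p q →
                    rowOf j q = rowOf j p + 1 ∧
                      ∀ x : HexVertex, (δ : ℂ) * hexCenter x ∈ ball ((δ : ℂ) * hexCenter q) ρ →
                        (x ∈ S n ↔ rowOf j x ≤ rowOf j p)) ∧
                  (∀ (n : ℕ) (p q : HexVertex), HasCleanWindow D.carrier δ ρ (T n) p q →
                    rowOf j q = rowOf j p + 1 ∧
                      ∀ x : HexVertex, (δ : ℂ) * hexCenter x ∈ ball ((δ : ℂ) * hexCenter q) ρ →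
                        (x ∈ T n ↔ rowOf j x ≤ rowOf j p))) ∧
                (∀ (n : ℕ) (p q : HexVertex), HasCleanWindow D.carrier δ ρ (S n) p q →
                  ∃ K : Set ℂ, IsCompact K ∧ IsConnected K ∧
                    (δ : ℂ) * hexCenter q - ((ρ / 2 : ℝ) : ℂ) * Complex.I * triZeta ^ (j : ℕ) ∈ K ∧
                    (δ : ℂ) * hexCenter (a δ) ∈ K ∧
                    ∀ v : HexVertex, Metric.infDist ((δ : ℂ) * hexCenter v) K ≤ ρ / 4 → v ∈ S n) ∧
                (∀ (n : ℕ) (p q : HexVertex), HasCleanWindow D.carrier δ ρ (T n) p q →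
                  ∃ K : Set ℂ, IsCompact K ∧ IsConnected K ∧
                    (δ : ℂ) * hexCenter q - ((ρ / 2 : ℝ) : ℂ) * Complex.I * triZeta ^ (j : ℕ) ∈ K ∧
                    (δ : ℂ) * hexCenter (b δ) ∈ K ∧
                    ∀ v : HexVertex, Metric.infDist ((δ : ℂ) * hexCenter v) K ≤ ρ / 4 → v ∈ T n) ∧
                (∀ n : ℕ, ∃ K : Set ℂ, IsCompact K ∧ IsConnected K ∧ (δ : ℂ) * hexCenter (a δ) ∈ K ∧
                  (∀ v : HexVertex, Metric.infDist ((δ : ℂ) * hexCenter v) K ≤ ρ / 8 → v ∈ S n) ∧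
                  (∀ v ∈ S n, ∃ (t w : HexVertex) (r : ℕ), v ∈ hexBall t r ∧ w ∈ hexBall t r ∧
                    hexBall t r ⊆ S n ∧ Metric.infDist ((δ : ℂ) * hexCenter w) K ≤ ρ / 16)) ∧
                (∀ n : ℕ, ∃ K : Set ℂ, IsCompact K ∧ IsConnected K ∧ (δ : ℂ) * hexCenter (b δ) ∈ K ∧
                  (∀ v : HexVertex, Metric.infDist ((δ : ℂ) * hexCenter v) K ≤ ρ / 8 → v ∈ T n) ∧
                  (∀ v ∈ T n, ∃ (t w : HexVertex) (r : ℕ), v ∈ hexBall t r ∧ w ∈ hexBall t r ∧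
                    hexBall t r ⊆ T n ∧ Metric.infDist ((δ : ℂ) * hexCenter w) K ≤ ρ / 16))) ∧
            hexSAWLaw D.carrier δ (a δ) (b δ)
                {γ | ¬ ∃ (n m : ℕ) (p q : HexVertex) (n' m' : ℕ) (p' q' : HexVertex),
                    IsFirstGoodGateN D.carrier δ ρ R S (a δ) γ.walk.support n m p q ∧
                    IsFirstGoodGateN D.carrier δ ρ R T (b δ) γ.walk.support.reverse n' m' p' q' ∧
                    WideLink D.carrier δ ρ (S n ∪ T n') q q'} ≤
              ENNReal.ofReal ε) :
    Summit.CriticalPhenomena.SAWScalingLimit.Theses.SAWQuarterTwist.AnchoredObservableToSLER :=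
  fun hM hS =>
    Summit.CriticalPhenomena.SAWScalingLimit.Theorems.ObservableToSLER.Residue.observableToSLER_of_residue3 h2 hM hS

end Summit.CriticalPhenomena.SAWScalingLimit.Cruxes.ObservableToSLER.StrategistS5

end
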